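import Summits.AtomisticToContinuum.Crystallization.Theorems.FrustratedLawDichotomyStrainedPatchHomEntryFitSharp
import Summits.AtomisticToContinuum.Crystallization.Theorems.FrustratedLawDichotomyStrainedPatchHomEntryFitHcp
import Summits.AtomisticToContinuum.Crystallization.Theorems.FrustratedLawDichotomyStrainedPatchHomEntryTable

/-!
# `(H) HomFloor (1/625)` FROM TWO CONCRETE BOOLEANS — the record entry-leaf verdicts of both hands combined

decomp-a2c hand-2 g22 (crux `AperiodicFrustratedLawGap`, stmt-AtomisticToContinuum-27623; critic rows 834 (B) / 836).  Assembly BY NAME of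
hand-2's sharp fit prune (`…HomEntryFitSharp.fitOK2`), hand-1's record fcc verdict (`…HomEntryTable.entryLeafOKT` = `fitOK ∨ asymOK ∨ colOutOK ∨ tableLeafOK`,
kernel checker of record per row 836, 0.4 s/leaf), hand-2's hcp verdict with the hcp fit prune (`…HomEntryFitHcp.entryLeafOKH2`), and hand-1's target constant
`muRec = ⌈2(1/625 − 0.71)·2⁴⁸⌉` (`muRec_ok`):

* `entryLeafOKR μ := fitOK2 ∨ entryLeafOKT μ` (record fcc verdict: sharp fit ∨ fit ∨ symmetry ∨ column ∨ table-(P4)) + soundness + `fccHalf_of_entryRecordTree`;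
* ★★★ `homFloor_of_recordTrees : 2(m+e_W)SC ≤ μ → treeOK (entryLeafOKR μ) tF rootC rootW = true → treeOK (entryLeafOKH2 μ) tH rootCH rootWH = true → HomFloor m`;
* ★★★ `homFloor_625_of_recordTrees : treeOK (entryLeafOKR muRec) tF rootC rootW = true → treeOK (entryLeafOKH2 muRec) tH rootCH rootWH = true → HomFloor (1/625)`
  — the (H) hypothesis of the 27623 T-side line of record (`…HomLeaf.aperiodicFrustratedLawGap_of_homFloor_relief_collarPieces_zero_625`) from two decidable
  equalities about explicit trees.

One definition (`entryLeafOKR`); 0 sorry; standard axioms; no instances / notation.  `--supports stmt-AtomisticToContinuum-27623`.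
-/

namespace Summit.AtomisticToContinuum.Crystallization.Theorems.FrustratedLawDichotomyStrainedPatchHomEntryRecord

open scoped BigOperators RealInnerProductSpace
open Literature.Analysis.ValidatedNumerics.Numerics
open Summit.AtomisticToContinuum.Crystallization.Theorems.ChargedEnergyGapNegative (E3)
open Summit.AtomisticToContinuum.Crystallization.Theorems.FrustratedLawDichotomySchurCut (effPot w₄₅ ω₄)
open Summit.AtomisticToContinuum.Crystallization.Theorems.FrustratedLawDichotomyAveragingRuleTightFree (TightNearCap BadNearCap)
open Summit.AtomisticToContinuum.Crystallization.Theorems.FrustratedLawDichotomyExemptAbsorption (ExemptNear)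
open Summit.AtomisticToContinuum.Crystallization.Theorems.FrustratedLawDichotomyStrainedPatchHomSplit
open Summit.AtomisticToContinuum.Crystallization.Theorems.FrustratedLawDichotomyStrainedPatchHomPrunedPolar (homFloor_of_prunedBoxSums_selfAdjoint)
open Summit.AtomisticToContinuum.Crystallization.Theorems.FrustratedLawDichotomyStrainedPatchHomCertTree (CertTree treeOK)
open Summit.AtomisticToContinuum.Crystallization.Theorems.FrustratedLawDichotomyStrainedPatchHomEntryGram
open Summit.AtomisticToContinuum.Crystallization.Theorems.FrustratedLawDichotomyStrainedPatchHomEntryFitSharp (fitOK2 fitOK2_sound)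
open Summit.AtomisticToContinuum.Crystallization.Theorems.FrustratedLawDichotomyStrainedPatchHomEntryGramHcp (rootCH rootWH)
open Summit.AtomisticToContinuum.Crystallization.Theorems.FrustratedLawDichotomyStrainedPatchHomEntryFitHcp (entryLeafOKH2 hcpHalf_of_entryFitTree)
open Summit.AtomisticToContinuum.Crystallization.Theorems.FrustratedLawDichotomyStrainedPatchHomEntryTable (entryLeafOKT entryLeafOKT_sound muRec muRec_ok)
open Literature.Barriers.AtomisticToContinuum.FlatleyTheil2015 (fccVec)

/-- ★ **RECORD fcc ENTRY-LEAF VERDICT**: hand-2's sharp fit prune ∨ hand-1's record verdict (`fitOK ∨ asymOK ∨ colOutOK ∨ tableLeafOK μ`). -/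
def entryLeafOKR (μ : ℤ) (c w : Fin 3 × Fin 3 → ℤ) : Bool := fitOK2 c w || entryLeafOKT μ c w

/-- ★ Soundness of `entryLeafOKR` (shape of `…HomEntryGram.fccHalf_of_entryTree`). [folklore] -/
theorem entryLeafOKR_sound {μ : ℤ} {c w : Fin 3 × Fin 3 → ℤ} (h : entryLeafOKR μ c w = true) (U : E3 →L[ℝ] E3)
    (hsa : ∀ v v' : E3, ⟪U v, v'⟫ = ⟪v, U v'⟫) (hU : ‖U - 1‖ ≤ 1 / 4)
    (hbox : ∀ ab : Fin 3 × Fin 3, |(U (EuclideanSpace.single ab.2 (1 : ℝ))) ab.1 - (c ab : ℝ) / SC| ≤ (w ab : ℝ) / SC) :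
    (∀ (M : ℕ) (z : Fin M → E3) (c : Fin M), Function.Injective z →
        Set.range z = {x : E3 | dist x (z c) ≤ 133 / 10 ∧ ∃ a : Fin 3 → ℤ, x = z c + latPt U fccVec a} →
        TightNearCap (9 / 5) (3 / 2) z c ∨ ExemptNear (9 / 5) ExRec z c ∨ BadNearCap (9 / 5) (3 / 2) z c) ∨
      (μ : ℝ) / SC ≤ ∑ b ∈ (Fintype.piFinset fun _ : Fin 3 => Finset.Icc (-7 : ℤ) 7).filter (fun b => b ≠ 0),
        effPot w₄₅ ω₄ (3 / 400) ‖latPt U fccVec b‖ := by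
  simp only [entryLeafOKR, Bool.or_eq_true] at h
  rcases h with h | h
  · exact Or.inl (fitOK2_sound h U hU hbox)
  · exact entryLeafOKT_sound h U hsa hU hbox

/-- ★★ The fcc half of `homFloor_of_prunedBoxSums_selfAdjoint` from ONE Boolean with the record verdict. [folklore] -/
theorem fccHalf_of_entryRecordTree {m : ℝ} {μ : ℤ} (hμ : 2 * (m + (-(7175 / 10000) + 3 / 400)) * SC ≤ μ)
    {t : CertTree (Fin 3 × Fin 3)} (h : treeOK (entryLeafOKR μ) t rootC rootW = true) :
    ∀ U : E3 →L[ℝ] E3, (∀ v w : E3, inner ℝ (U v) w = inner ℝ v (U w)) → (∀ w : E3, 0 ≤ inner ℝ w (U w)) → ‖U - 1‖ ≤ 1 / 4 →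
      (∀ (M : ℕ) (z : Fin M → E3) (c : Fin M), Function.Injective z →
          Set.range z = {x : E3 | dist x (z c) ≤ 133 / 10 ∧ ∃ a : Fin 3 → ℤ, x = z c + latPt U fccVec a} →
          TightNearCap (9 / 5) (3 / 2) z c ∨ ExemptNear (9 / 5) ExRec z c ∨ BadNearCap (9 / 5) (3 / 2) z c) ∨
      m ≤ (∑ b ∈ (Fintype.piFinset fun _ : Fin 3 => Finset.Icc (-7 : ℤ) 7).filter (fun b => b ≠ 0),
        effPot w₄₅ ω₄ (3 / 400) ‖latPt U fccVec b‖) / 2 - (-(7175 / 10000) + 3 / 400) :=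
  fccHalf_of_entryTree hμ (entryLeafOKR μ) (fun _ _ hv U hsa hU hbox => entryLeafOKR_sound hv U hsa hU hbox) h

/-- ★★★ **`HomFloor m` FROM THE TWO RECORD TREE VERDICTS.** [folklore] -/
theorem homFloor_of_recordTrees {m : ℝ} {μ : ℤ} (hμ : 2 * (m + (-(7175 / 10000) + 3 / 400)) * SC ≤ μ)
    {tF : CertTree (Fin 3 × Fin 3)} (hF : treeOK (entryLeafOKR μ) tF rootC rootW = true)
    {tH : CertTree ((Fin 3 × Fin 3) ⊕ Fin 3)} (hH : treeOK (entryLeafOKH2 μ) tH rootCH rootWH = true) : HomFloor m :=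
  homFloor_of_prunedBoxSums_selfAdjoint (fccHalf_of_entryRecordTree hμ hF) (hcpHalf_of_entryFitTree hμ hH)

/-- ★★★ **`(H) HomFloor (1/625)` — the hypothesis of the 27623 T-side line of record — FROM TWO DECIDABLE EQUALITIES** about explicit certificate trees
(`μ = muRec = −398793747003657`). [folklore] -/
theorem homFloor_625_of_recordTrees {tF : CertTree (Fin 3 × Fin 3)} (hF : treeOK (entryLeafOKR muRec) tF rootC rootW = true)
    {tH : CertTree ((Fin 3 × Fin 3) ⊕ Fin 3)} (hH : treeOK (entryLeafOKH2 muRec) tH rootCH rootWH = true) : HomFloor (1 / 625) :=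
  homFloor_of_recordTrees muRec_ok hF hH

end Summit.AtomisticToContinuum.Crystallization.Theorems.FrustratedLawDichotomyStrainedPatchHomEntryRecord
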